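import Summits.NavierStokesRegularity.OSWSelfSimilar.SheetRowThirdHilbert
import HarnessLib

/-!
# SHEET-ℝ of the viscous gCLM/OSW profile MODEL: the Schochet corner of the NS-type line is an exact double pole,
# and it is the ONLY double-pole point of that line (algebraic kernel + the genuine Hilbert transform)

HONEST FRAMING (cell ns-blowup GROUP B «PROFILE SEARCH», zone Z3, case Z3-E12⁻ of `HOME/profile/z3/SHEET.md` §13;
human rulings D-0035/D-0074): **1-D MODEL (viscous generalised Constantin–Lax–Majda / Okamoto–Sakajo–Wunsch profile
equation on `ℝ`); not Euler, not Navier–Stokes; «violates: none — MODEL».** Nothing here is a statement about Navier–Stokes.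

OBJECT. The frozen-`ε` profile sheet `G(Ω; c_ω, c_l, a, ε) := c_ω Ω + c_l ξ Ω′ + a 𝒰 Ω′ − (HΩ) Ω − ε Ω″ = 0`, `𝒰′ = HΩ`,
`𝒰(0) = 0` (`SheetRowThirdExactFamily`, `HOME/profile/z3/SHEET.md` §1.2). Its NS-type (constant-viscosity) line is
`{c_l = c_ω/2}` (`ε ≡ const ⇔ 2c_l = c_ω`; in the sheet gauge `c_ω = 1` this is the familiar `c_l = 1/2`). In the AMPLITUDE
gauge of SHEET §13 (`Ω′(0) = −1`, `ε` fixed) the parameter `c_ω` is free and the line has a DEGENERATE CORNER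
`(c_ω, c_l, a) = (0, 0, 0)`, where `G` reduces to `−(HΩ)Ω − εΩ″ = 0`.

THE FACTS (pen-and-paper algebra on the dilated double pole `Ω(η) = −A f(η/ℓ)`, `f(x) = x/(1+x²)²`, reusing the calculus and the
residual `rowResidual` of `SheetRowThirdExactFamily` and the GENUINE p.v. Hilbert transform of `SheetRowThirdHilbert` /
`Literature.Analysis.Fourier.HilbertTransformLine`):
* `rowResidual_smul` — the amplitude symmetry (S-amp) of the sheet: `rowResidual (μc_ω) (μc_l) a (με) (μA) ℓ x = μ²·rowResidual …`.
* `rowResidual_degenerate_eq` — on the degenerate line `c_ω = c_l = 0` the residual of the ansatz factors as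
  `(A x/(2(1+x²)⁴))·((3Aa − A + 24ε/ℓ²)x² + (A − Aa − 24ε/ℓ²))`; hence (`corner_solves`, `corner_converse`) it vanishes identically
  iff `a = 0` and `A ℓ² = 24 ε` (for `A ≠ 0`): the one-parameter (dilation) family `Ω_ℓ(η) = −24εℓ·η/(η²+ℓ²)²`
  (`corner_profile_explicit`) — SCHOCHET's quasi-static viscous profile [Schochet 1986; Ambrose–Lushnikov–Siegel–Silantyev 2024
  §5.1.1: `ω ≃ −24ṽ (t_c − t)^{−2} ξ/(ξ² + ṽ²)²`, `ξ = x/(t_c − t)` for `a = 0`, `σ = 2`], read in sheet coordinates: `C_ω = (T−t)^{−2}`,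
  `C_l = (T−t)^{−1}` give `c_l/c_ω = 1/2` (NS-type), `ε = νC_l²/C_ω = ν` (constant) and `c_ω = 2(T−t) → 0` — the corner.
* `nsLine_doublePole_iff_corner` — ON THE NS-TYPE LINE the double-pole ansatz solves the sheet equation identically iff
  `c_ω = 0 ∧ a = 0 ∧ Aℓ² = 24ε`: by (S-amp) and `SheetRowThirdExactFamily.eq_third_of_rowResidual_eq_zero` a solution with
  `c_ω ≠ 0` would sit on the row `c_l/c_ω = 1/3 ≠ 1/2`. So the Schochet corner is the unique double-pole point of the NS-type line
  (the numerically continued branch E½ of SHEET §7/§13 is NOT a double pole for `a > 0`; it converges to `Ω_ℓ` as `a → 0⁺`).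
* `schochetCorner_solves_nsLine_equation` — END TO END with `H = hilbertTransform`: `𝒰(0) = 0`, `𝒰′ = HΩ`, and
  `(HΩ)(ξ)·Ω(ξ) + ε·Ω″(ξ) = 0` at every `ξ` (`Ω″ = deriv (deriv Ω)`), i.e. `G(Ω; 0, 0, 0, ε) = 0`.
* `corner_amplitude_gauge` — in the amplitude gauge `Ω′(0) = −1` the corner member has `ℓ³ = 24ε` and then `HΩ(0) = ℓ/2`
  (for `ε = 1`: `ℓ = 24^{1/3}`, `HΩ(0) = 24^{1/3}/2 = 1.44225…`, the values the Z3 engine reproduces to `1e-9`, SHEET §13.1).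
WHAT IS NOT HERE: no statement that other (non-double-pole) profiles do or do not exist on the NS-type line (the E½ branch for
`0 < a < a_½` is a float64 object of the cell; the blow-up-sector null search for `a < 0` is numerics, SHEET §13.3); no dynamics;
no energy identity. No `def … : Prop` hypotheses; no new definitions. bears_on: LADDER-NS N5 / zone Z3 (case Z3-E12⁻) → N1 linear core.
-/

namespace Summit.NavierStokesRegularity.OSWSelfSimilar
namespace SheetNSLineSchochetCorner

open SheetRowThirdExactFamily Literature.Analysis.Fourier

/-- (S-amp) on the ansatz residual: scaling `(c_ω, c_l, ε, A) ↦ μ·(c_ω, c_l, ε, A)` multiplies `rowResidual` by `μ²`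
(every term of `G` is of degree two in `(coefficients, Ω)`). [folklore] -/
theorem rowResidual_smul (μ cω cl a ε A ℓ x : ℝ) :
    rowResidual (μ * cω) (μ * cl) a (μ * ε) (μ * A) ℓ x = μ ^ 2 * rowResidual cω cl a ε A ℓ x := by
  unfold rowResidual
  ring

/-- On the degenerate line `c_ω = c_l = 0` the residual of `Ω = −A f(·/ℓ)` factors through an explicit even quadratic.
[new here — MODEL] -/
theorem rowResidual_degenerate_eq (a ε A ℓ x : ℝ) (hℓ : ℓ ≠ 0) :
    rowResidual 0 0 a ε A ℓ x
      = (A * x / (2 * (1 + x ^ 2) ^ 4)) * ((3 * A * a - A + 24 * ε / ℓ ^ 2) * x ^ 2 + (A - A * a - 24 * ε / ℓ ^ 2)) := by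
  have hne : (1 : ℝ) + x ^ 2 ≠ 0 := by positivity
  unfold rowResidual profile hilbProfile primProfile dProfile ddProfile
  field_simp
  ring

/-- THE SCHOCHET CORNER: at `(c_ω, c_l, a) = (0, 0, 0)` the dilated double pole with `A ℓ² = 24 ε` solves the sheet equation
identically in `x` — for EVERY width `ℓ ≠ 0` (the dilation family of the corner). [new here — MODEL; Schochet 1986 / ALSS 2024 §5.1.1] -/
theorem corner_solves {ε A ℓ : ℝ} (hℓ : ℓ ≠ 0) (hA : A * ℓ ^ 2 = 24 * ε) (x : ℝ) :
    rowResidual 0 0 0 ε A ℓ x = 0 := by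
  rw [rowResidual_degenerate_eq _ _ _ _ _ hℓ]
  have hℓ2 : ℓ ^ 2 ≠ 0 := pow_ne_zero 2 hℓ
  have h24 : 24 * ε / ℓ ^ 2 = A := by
    rw [← hA]
    field_simp
  rw [h24]
  ring

/-- CONVERSE on the degenerate line: if `Ω = −A f(·/ℓ)` with `A ≠ 0`, `ℓ ≠ 0` solves `c_ω = c_l = 0` identically, then `a = 0`
and `A ℓ² = 24 ε` — the corner is isolated in `a` as well. [new here — MODEL] -/
theorem corner_converse {a ε A ℓ : ℝ} (hA : A ≠ 0) (hℓ : ℓ ≠ 0)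
    (h : ∀ x : ℝ, rowResidual 0 0 a ε A ℓ x = 0) : a = 0 ∧ A * ℓ ^ 2 = 24 * ε := by
  have hq : ∀ x : ℝ, x ≠ 0 → (3 * A * a - A + 24 * ε / ℓ ^ 2) * x ^ 2 + (A - A * a - 24 * ε / ℓ ^ 2) = 0 := by
    intro x hx
    have hx' := h x
    rw [rowResidual_degenerate_eq _ _ _ _ _ hℓ] at hx'
    have hpre : A * x / (2 * (1 + x ^ 2) ^ 4) ≠ 0 := by
      have hne : (1 : ℝ) + x ^ 2 ≠ 0 := by positivity
      exact div_ne_zero (mul_ne_zero hA hx) (mul_ne_zero two_ne_zero (pow_ne_zero 4 hne))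
    exact (mul_eq_zero.mp hx').resolve_left hpre
  have h1 := hq 1 one_ne_zero
  have h2 := hq 2 two_ne_zero
  norm_num at h1 h2
  have hℓ2 : ℓ ^ 2 ≠ 0 := pow_ne_zero 2 hℓ
  -- the quadratic vanishes at y = 1 and y = 4, so both coefficients vanish
  have c2 : 3 * A * a - A + 24 * ε / ℓ ^ 2 = 0 := by linarith
  have c0 : A - A * a - 24 * ε / ℓ ^ 2 = 0 := by linarith
  have hAa : A * a = 0 := by linarith
  have ha : a = 0 := (mul_eq_zero.mp hAa).resolve_left hA
  refine ⟨ha, ?_⟩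
  have hd : 24 * ε / ℓ ^ 2 = A := by
    rw [ha] at c0
    linarith
  calc A * ℓ ^ 2 = 24 * ε / ℓ ^ 2 * ℓ ^ 2 := by rw [hd]
    _ = 24 * ε := by field_simp

/-- **THE NS-TYPE LINE MEETS THE DOUBLE-POLE ANSATZ ONLY AT THE SCHOCHET CORNER.** For `A ≠ 0`, `ℓ ≠ 0`: the dilated double pole
solves the sheet equation identically on the constant-viscosity line `c_l = c_ω/2` iff `c_ω = 0`, `a = 0` and `A ℓ² = 24 ε`.
(For `c_ω ≠ 0` the amplitude symmetry maps the line point to the sheet gauge `c_ω = 1`, `c_l = 1/2`, where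
`eq_third_of_rowResidual_eq_zero` forces `c_l = 1/3` — contradiction.) [new here — MODEL] -/
theorem nsLine_doublePole_iff_corner {cω a ε A ℓ : ℝ} (hA : A ≠ 0) (hℓ : ℓ ≠ 0) :
    (∀ x : ℝ, rowResidual cω (cω / 2) a ε A ℓ x = 0) ↔ (cω = 0 ∧ a = 0 ∧ A * ℓ ^ 2 = 24 * ε) := by
  constructor
  · intro h
    by_cases hc : cω = 0
    · have h0 : ∀ x : ℝ, rowResidual 0 0 a ε A ℓ x = 0 := by
        intro x
        have := h x
        rwa [hc, zero_div] at this
      exact ⟨hc, corner_converse hA hℓ h0⟩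
    · exfalso
      -- rescale to c_ω = 1
      have h1 : ∀ x : ℝ, rowResidual 1 (1 / 2) a (cω⁻¹ * ε) (cω⁻¹ * A) ℓ x = 0 := by
        intro x
        have hs := rowResidual_smul cω⁻¹ cω (cω / 2) a ε A ℓ x
        have e1 : cω⁻¹ * cω = 1 := inv_mul_cancel₀ hc
        have e2 : cω⁻¹ * (cω / 2) = 1 / 2 := by
          field_simp
        rw [e1, e2] at hs
        rw [hs, h x, mul_zero]
      have hA' : cω⁻¹ * A ≠ 0 := mul_ne_zero (inv_ne_zero hc) hA
      have hthird := (eq_third_of_rowResidual_eq_zero hA' hℓ h1).1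
      norm_num at hthird
  · rintro ⟨hc, ha, hAℓ⟩
    intro x
    rw [hc, zero_div, ha]
    exact corner_solves hℓ hAℓ x

/-- The corner member written out: `−(24ε/ℓ²)·f(η/ℓ) = −24εℓ·η/(η² + ℓ²)²` (`ℓ ≠ 0`) — Schochet's profile with `ṽ = ℓ`
for `ε = 1`. [Schochet 1986; ALSS 2024 §5.1.1] -/
theorem corner_profile_explicit {ε ℓ : ℝ} (hℓ : ℓ ≠ 0) (η : ℝ) :
    -(24 * ε / ℓ ^ 2) * profile (η / ℓ) = -(24 * ε * ℓ) * η / (η ^ 2 + ℓ ^ 2) ^ 2 := by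
  have hne : η ^ 2 + ℓ ^ 2 ≠ 0 := by positivity
  unfold profile
  field_simp
  ring

/-- **THE SCHOCHET CORNER, END TO END (MODEL theorem, genuine Hilbert transform):** for `ℓ > 0` the functions
`Ω(η) = −(24ε/ℓ²)·f(η/ℓ)` (`= −24εℓ·η/(η²+ℓ²)²`) and `𝒰(η) = −(24ε/ℓ²)·ℓ·𝒰_f(η/ℓ)` satisfy `𝒰(0) = 0`, `𝒰′ = HΩ` with
`H = Literature.Analysis.Fourier.hilbertTransform`, and the sheet equation at the degenerate corner of the NS-type line,
`G(Ω; 0, 0, 0, ε) = −(HΩ)Ω − εΩ″ = 0`, i.e. `(HΩ)(ξ)·Ω(ξ) + ε·Ω″(ξ) = 0` at every `ξ ∈ ℝ` (`Ω″ = deriv (deriv Ω)`).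
WHAT THIS IS NOT: not NS — the `a = 0` (Constantin–Lax–Majda) member of the 1-D model with Laplacian dissipation, whose
blow-up is `(T − t)^{−2}`, not `(T − t)^{−1}`. [new here — MODEL; profile from Schochet 1986 / ALSS 2024 §5.1.1] -/
theorem schochetCorner_solves_nsLine_equation {ε ℓ : ℝ} (hℓ : 0 < ℓ) (Ω U : ℝ → ℝ)
    (hΩ : Ω = fun η => -(24 * ε / ℓ ^ 2) * profile (η / ℓ))
    (hU : U = fun η => -(24 * ε / ℓ ^ 2) * ℓ * primProfile (η / ℓ)) :
    U 0 = 0 ∧ (∀ ξ, HasDerivAt U (hilbertTransform Ω ξ) ξ) ∧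
      ∀ ξ, hilbertTransform Ω ξ * Ω ξ + ε * deriv (deriv Ω) ξ = 0 := by
  have hℓ0 : ℓ ≠ 0 := hℓ.ne'
  subst hΩ hU
  refine ⟨dilatedPrim_zero _ _, fun ξ => hasDerivAt_dilatedPrim _ hℓ ξ, fun ξ => ?_⟩
  rw [deriv_deriv_dilatedProfile _ hℓ0 ξ, hilbertTransform_dilatedProfile _ hℓ ξ]
  have hAℓ : 24 * ε / ℓ ^ 2 * ℓ ^ 2 = 24 * ε := by field_simp
  have key := corner_solves (A := 24 * ε / ℓ ^ 2) hℓ0 hAℓ (ξ / ℓ)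
  unfold rowResidual at key
  simp only
  linear_combination -key

/-- Slope and origin value of `HΩ` for the dilated double pole: `Ω′(0) = −A/ℓ`, `HΩ(0) = A/2`. [folklore] -/
theorem dilatedProfile_origin (A : ℝ) {ℓ : ℝ} (hℓ : 0 < ℓ) :
    deriv (fun η => -A * profile (η / ℓ)) 0 = -(A / ℓ) ∧
      hilbertTransform (fun η => -A * profile (η / ℓ)) 0 = A / 2 := by
  have hℓ0 : ℓ ≠ 0 := hℓ.ne'
  refine ⟨?_, ?_⟩
  · rw [deriv_dilatedProfile _ hℓ0]
    simp [dProfile_zero]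
  · rw [hilbertTransform_dilatedProfile _ hℓ 0, zero_div, hilbProfile_zero]
    ring

/-- **The corner in the amplitude gauge of SHEET §13** (`Ω′(0) = −1`): the member `A = 24ε/ℓ²` has `Ω′(0) = −24ε/ℓ³`, so the
normalisation reads `ℓ³ = 24ε`, and then `HΩ(0) = ℓ/2` (for `ε = 1`: `ℓ = 24^{1/3} = 2.8845`, `HΩ(0) = 1.4422` — the numbers
the cell's engine reproduces at the corner to `1e-9`, SHEET §13.1). [new here — MODEL] -/
theorem corner_amplitude_gauge {ε ℓ : ℝ} (hℓ : 0 < ℓ) (hnorm : ℓ ^ 3 = 24 * ε) :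
    deriv (fun η => -(24 * ε / ℓ ^ 2) * profile (η / ℓ)) 0 = -1 ∧
      hilbertTransform (fun η => -(24 * ε / ℓ ^ 2) * profile (η / ℓ)) 0 = ℓ / 2 := by
  have hℓ0 : ℓ ≠ 0 := hℓ.ne'
  obtain ⟨h1, h2⟩ := dilatedProfile_origin (24 * ε / ℓ ^ 2) hℓ
  refine ⟨?_, ?_⟩
  · rw [h1]
    have : 24 * ε = ℓ ^ 3 := hnorm.symm
    rw [this]
    field_simp
  · rw [h2]
    have : 24 * ε = ℓ ^ 3 := hnorm.symm
    rw [this]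
    field_simp

end SheetNSLineSchochetCorner
end Summit.NavierStokesRegularity.OSWSelfSimilar
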